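import Summits.PneNP.PneNP.Theorems.MonotoneContinuation.Negative.LocalStability
import Summits.PneNP.PneNP.Theorems.MonotoneContinuation.Negative.StarParity
import Summits.PneNP.PneNP.Theorems.OneSliceSliceMonotonization
import Summits.PneNP.PneNP.Theorems.SliceACZero.Negative.LoadBearing

/-!
# `MonotoneContinuation` (stmt-PneNP-18471) — negative-side lemmas III: transport rigidity fails (`C'` must differ from `C`)

MC promises, for a small `{∧₂,∨₂}`-circuit `C` whose slice-`j` transport `T_j 𝟙[C]` is `ε`-close in `L¹(G(n,p_c))` to a monotone
Boolean function, a small `{∧₂,∨₂}`-circuit `C'` `η`-close to that transport. Here: `C'` can NOT in general be `C` itself (nor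
anything equal to `C` off a null set), even when the hypothesis holds with `ε → 0` — off the slice a slice-accurate monotone
circuit is adversarial.
* `exists_monotone_threshold` — `{∧₂,∨₂}`-circuits with `≤ 22·C(n,2)³ + C(n,2)` gates computing `[t ≤ #edges]` (`2 ≤ t ≤ C(n,2)`):
  the AND of the pseudo-complements `Th_{t-1}(x - x_e)` of the tree's Paterson–Wegener program, constants eliminated.
* `eventually_rigidity_witness` — every `k ≥ 3`, `ε > 0`, eventually: `j = m - ⌊m^{3/4}⌋` (central) and `C = x_{e₀} ∨ T_{≥ j+1}`
  (`≤ n^7` gates) have slice-`j` function `x_{e₀}`, transport `ε`-close to the monotone dictator `y_{e₀}` (`LocalStability` with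
  `T = {e₀}`), yet `‖𝟙[C] − T_j𝟙[C]‖ ≥ 1/2` since `C ≡ 1` on `{|y| ≥ j+1}` (mass `≥ 1 - 8m^{-1/4}`, Chebyshev).
* `not_transportRigidity` — the strengthening "`C' := C` works" (work file: `TransportRigidity`, inline here) is FALSE
  (`c = 7`, `η = 1/4`, every `k ≥ 3`). So `C'` must be BUILT from the profile `ĝ_C`/`F`, not read off the gates of `C`.
Work file `Summits/PneNP/PneNP/Cruxes/MonotoneContinuation/Disproof.lean`; refuter seat refuter-cdisprove-stmt-PneNP-18471-0, 2026-08-17.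
-/
set_option linter.dupNamespace false

namespace Summit.PneNP.PneNP.Theorems.MonotoneContinuation.Negative

open Literature.Computability.Complexity hiding supp mem_supp
open Literature.Computability.Complexity.GateList (wireOf vals const_or_exists_monotone_circuit or_mem_monotoneBasis)
open Finset hiding slice
open Filter hiding mem_sdiff
open Classical
open Summit.PneNP.PneNP.Theorems.ConstantBand.Negative (Edge thr Central central_thr slice)
open Summit.PneNP.PneNP.Theorems.SliceACZero.Negative (supp mem_supp card_supp supp_injective supp_indicator exists_edge)
open Summit.PneNP.PneNP.Theorems.SingleThreshold.Negative (pc pc_nonneg pc_le_one)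
open Summit.PneNP.PneNP.Theorems.SliceTargetSplit (Comp nbhd mem_nbhd transport ind l1 nbhdCard
  ind_nonneg ind_le_one l1_comm l1_triangle l1_eq_sum_slices)
open Summit.PneNP.PneNP.Theorems (binomialWeight_sum_range binomialWeight_nonneg binomialWeight_tail_le card_slice
  eventually_window tendsto_mean central_add_le oneSlice_hammingWeight_comp oneSlice_size2_le)

noncomputable section

variable {n : ℕ}

/-! ### Part D1. Monotone threshold circuits over `{∧₂,∨₂}` (from the pseudo-complement program) -/

/-- The count of ones outside coordinate `i`. [folklore] -/
theorem card_filter_ne_eq {N : ℕ} (y : Fin N → Bool) (i : Fin N) :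
    (univ.filter fun j => j ≠ i ∧ y j = true).card = hammingWeight y - (if y i = true then 1 else 0) := by
  unfold hammingWeight
  have hsplit : (univ.filter fun j => y j = true)
      = (univ.filter fun j => j ≠ i ∧ y j = true) ∪ (if y i = true then {i} else ∅) := by
    ext j
    by_cases hji : j = i
    · subst hji
      cases h : y j <;> simp [h]
    · cases hyi : y i <;> simp [hji]
  have hdisj : Disjoint (univ.filter fun j => j ≠ i ∧ y j = true) (if y i = true then {i} else ∅) := by
    cases y i <;> simp
  rw [hsplit, card_union_of_disjoint hdisj]
  cases y i <;> simp

/-- **The AND of all pseudo-complements is the next threshold**: for `1 ≤ M` and `1 ≤ N`,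
`⋀ᵢ [M ≤ |y| - yᵢ] = [M + 1 ≤ |y|]`. [folklore] -/
theorem all_pseudoComplement_eq {N M : ℕ} (hM : 1 ≤ M) (hN : 1 ≤ N) (y : Fin N → Bool) :
    ((univ : Finset (Fin N)).toList.all fun i => pseudoComplement M i y) = decide (M + 1 ≤ hammingWeight y) := by
  rw [Bool.eq_iff_iff, List.all_eq_true]
  simp only [Finset.mem_toList, mem_univ, true_implies, pseudoComplement, decide_eq_true_eq, card_filter_ne_eq]
  constructor
  · intro h
    by_contra hlt
    push Not at hlt
    rcases Nat.eq_zero_or_pos (hammingWeight y) with h0 | hpos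
    · have := h ⟨0, hN⟩
      rw [h0] at this
      simp only [Nat.zero_sub, nonpos_iff_eq_zero] at this
      omega
    · have hne : (univ.filter fun j : Fin N => y j = true).Nonempty := by
        rw [← Finset.card_pos]; exact hpos
      obtain ⟨i, hi⟩ := hne
      have hyi : y i = true := (mem_filter.1 hi).2
      have := h i
      rw [hyi, if_pos rfl] at this
      omega
  · intro h i
    cases y i <;> simp <;> omega

/-- **Monotone threshold circuits.** For `2 ≤ t ≤ C(n,2)` there is a `{∧₂,∨₂}`-circuit with at most `22·C(n,2)³ + C(n,2)`
gates computing `[t ≤ #edges(x)]` exactly (the AND of the `C(n,2)` pseudo-complements `Th_{t-1}(x - x_e)` of the tree's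
Paterson–Wegener program `PseudoCompl.cktSize_pseudoComplements`, constants eliminated by `const_or_exists_monotone_circuit`). [folklore] -/
theorem exists_monotone_threshold {n t : ℕ} (ht2 : 2 ≤ t) (htN : t ≤ n.choose 2) :
    ∃ C : Circuit (Edge n), C.IsOver monotoneBasis ∧ C.size ≤ 22 * (n.choose 2) ^ 3 + n.choose 2 ∧
      ∀ x, C.eval x = decide (t ≤ edgeCount x) := by
  set N := n.choose 2 with hNdef
  have hN1 : 1 ≤ N := by omega
  have hcard : Fintype.card (Edge n) = N := by rw [hNdef]; exact card_edgeSet_top_fin n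
  set e : Edge n ≃ Fin N := (Fintype.equivFin (Edge n)).trans (finCongr hcard) with he
  set M := t - 1 with hM
  have hM1 : 1 ≤ M := by omega
  have htM : t = M + 1 := by omega
  -- the program: all pseudo-complements, then the AND of all of them
  have hne : (univ : Finset (Fin N)).toList ≠ [] :=
    Finset.Nonempty.toList_ne_nil ⟨⟨0, hN1⟩, mem_univ _⟩
  have hP := PseudoCompl.cktSize_pseudoComplements N M
  have hA := (cktSize_all (univ : Finset (Fin N)).toList hne).basis_mono monotoneBasis_subset_monotoneBasis01
  have hG := (hP.comp hA).rewire (ι' := Edge n) (fun i => e.symm i)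
  obtain ⟨gs, out, hl, hR⟩ := hG
  have hfun : ∀ x : Edge n → Bool,
      wireOf x (vals gs x) (out ()) = decide (t ≤ edgeCount x) := by
    intro x
    rw [hR.eval x ()]
    show ((univ : Finset (Fin N)).toList.all fun i => pseudoComplement M i fun j => x (e.symm j)) = _
    rw [all_pseudoComplement_eq hM1 hN1, htM]
    congr 1
    rw [oneSlice_hammingWeight_comp e x]
    rfl
  rcases const_or_exists_monotone_circuit gs (out ()) hR.wf hR.isOver (hR.outOK ()) with ⟨b, hb⟩ | ⟨C₂, hB₂, hs₂, hev₂⟩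
  · -- constant: impossible, the threshold is `0` at `∅` and `1` at the full vector
    exfalso
    have h0 := hb (fun _ => false)
    have h1 := hb (fun _ => true)
    rw [hfun] at h0 h1
    have hc0 : edgeCount (fun _ : Edge n => false) = 0 := by simp [edgeCount]
    have hc1 : edgeCount (fun _ : Edge n => true) = N := by
      simp only [edgeCount, Finset.filter_true_of_mem, mem_univ, implies_true, card_univ]
      exact hcard
    rw [hc0] at h0
    rw [hc1] at h1
    have : decide (t ≤ 0) = decide (t ≤ N) := h0.trans h1.symm
    rw [decide_eq_decide] at this
    omega
  · refine ⟨C₂, hB₂, hs₂.trans (hl.trans ?_), fun x => by rw [hev₂, hfun]⟩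
    have := oneSlice_size2_le (N := N) hN1
    have hlen : (univ : Finset (Fin N)).toList.length = N := by rw [Finset.length_toList, card_univ, Fintype.card_fin]
    omega

/-! ### Part D2. The rigidity witness: `x_{e₀} ∨ T_{≥ j+1}` at the bottom of the window -/

/-- **OR of a variable and a circuit** costs one more gate. [folklore] -/
theorem exists_or_input {n : ℕ} (e₀ : Edge n) (D : Circuit (Edge n)) (hD : D.IsOver monotoneBasis) :
    ∃ C : Circuit (Edge n), C.IsOver monotoneBasis ∧ C.size ≤ D.size + 1 ∧ ∀ x, C.eval x = (x e₀ || D.eval x) := by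
  have h1 := (CktSize.proj monotoneBasis fun _ : Unit => e₀).pair (Circuit.cktSize_eval D hD)
  have h2 := h1.comp (CktSize.gate (ι := Unit ⊕ Unit) (B := monotoneBasis) (GateFn.or 2)
    or_mem_monotoneBasis ![Sum.inl (), Sum.inr ()])
  obtain ⟨C, hCB, hCs, hCe⟩ := h2.toCircuit
  refine ⟨C, hCB, by omega, fun x => ?_⟩
  rw [hCe x]
  simp only [GateFn.or, Fin.exists_fin_two, Matrix.cons_val_zero, Matrix.cons_val_one, Sum.elim_inl, Sum.elim_inr,
    Bool.decide_or, Bool.decide_eq_true]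

/-- The dictator `y ↦ y e₀` is `{e₀}`-local. [folklore] -/
theorem dictator_local (e₀ : Edge n) : LocalOn ({e₀} : Finset (Edge n)) (fun y : Edge n → Bool => y e₀) :=
  fun _ _ h => h e₀ (mem_singleton_self e₀)

/-- `Pr[|G(n,p)| ≤ j]` as a binomial sum. [folklore] -/
theorem sum_gnpWeight_ite_edgeCount_le (p : ℝ) (j : ℕ) :
    ∑ y : Edge n → Bool, gnpWeight n p y * (if edgeCount y ≤ j then (1 : ℝ) else 0)
      = ∑ i ∈ (range (n.choose 2 + 1)).filter (fun i => i ≤ j),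
          ((n.choose 2).choose i : ℝ) * p ^ i * (1 - p) ^ (n.choose 2 - i) := by
  have h := l1_eq_sum_slices (n := n) p (fun y => if edgeCount y ≤ j then (1 : ℝ) else 0) (fun _ => 0)
  unfold l1 at h
  simp only [sub_zero] at h
  have habs : ∀ y : Edge n → Bool, |(if edgeCount y ≤ j then (1 : ℝ) else 0)|
      = (if edgeCount y ≤ j then (1 : ℝ) else 0) := fun y => by split_ifs <;> simp
  simp only [habs] at h
  rw [h, sum_filter]
  refine sum_congr rfl fun i _ => ?_
  have hin : ∑ y ∈ slice n i, (if edgeCount y ≤ j then (1 : ℝ) else 0) = if i ≤ j then ((n.choose 2).choose i : ℝ) else 0 := by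
    have : ∀ y ∈ slice n i, (if edgeCount y ≤ j then (1 : ℝ) else 0) = if i ≤ j then 1 else 0 := by
      intro y hy; rw [(mem_filter.1 hy).2]
    rw [sum_congr rfl this, sum_const, card_slice, nsmul_eq_mul]
    split_ifs <;> simp
  rw [hin]
  split_ifs <;> ring

/-- `Pr[y e₀ = 1] = p`. [folklore] -/
theorem sum_gnpWeight_ite_coord (p : ℝ) (e₀ : Edge n) :
    ∑ y : Edge n → Bool, gnpWeight n p y * (if y e₀ = true then (1 : ℝ) else 0) = p := by
  have h := sum_gnpWeight_filter_forall (n := n) p ({e₀} : Finset (Edge n))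
  simp only [mem_singleton, forall_eq, card_singleton, pow_one] at h
  simp_rw [mul_boole]
  rw [← sum_filter]
  exact h

set_option maxHeartbeats 400000 in
/-- **The rigidity witness, eventually** (every `k ≥ 3`, every `ε > 0`): for all large `n` there are a central `j` (the bottom
of the window, `j = m - ⌊m^{3/4}⌋`) and a `{∧₂,∨₂}`-circuit `C = x_{e₀} ∨ T_{≥ j+1}` with `≤ n^7` gates such that the slice-`j`
transport of `C` is `ε`-close to the monotone dictator `y_{e₀}` (the hypothesis of MC holds) while `C` itself is `≥ 1/2`-far
from that transport (`C ≡ 1` on `{|y| ≥ j+1}`, which has `G(n,p_c)`-mass `→ 1`). [folklore] -/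
theorem eventually_rigidity_witness {k : ℕ} (hk : 3 ≤ k) {ε : ℝ} (hε : 0 < ε) :
    ∀ᶠ n : ℕ in atTop, ∃ j : ℕ, Central k n j ∧ ∃ C : Circuit (Edge n), C.IsOver monotoneBasis ∧ C.size ≤ n ^ 7 ∧
      (∃ F : (Edge n → Bool) → Bool, Monotone F ∧ l1 n (pc n k) (ind F) (transport j (ind C.eval)) ≤ ε) ∧
      (1 / 2 : ℝ) ≤ l1 n (pc n k) (ind C.eval) (transport j (ind C.eval)) := by
  have hm : Tendsto (fun n : ℕ => (thr k n : ℝ)) atTop atTop :=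
    tendsto_natCast_atTop_atTop.comp (tendsto_nat_floor_atTop.comp (tendsto_mean hk))
  have hA : Tendsto (fun n : ℕ => (thr k n : ℝ) ^ ((1 : ℝ) / 4)) atTop atTop :=
    (tendsto_rpow_atTop (by norm_num)).comp hm
  have hε4 : 0 < min ε (1 / 4) := lt_min hε (by norm_num)
  filter_upwards [eventually_window hk 1, hA.eventually_ge_atTop (max 64 (9 / min ε (1 / 4))), eventually_ge_atTop 23]
    with n hwin hAge hn23
  obtain ⟨hp0, hp8, h34, -, hwin5⟩ := hwin
  have hp1 : pc n k ≤ 1 := by linarith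
  set N := n.choose 2 with hNdef
  set m : ℝ := (thr k n : ℝ) with hmdef
  set A : ℝ := m ^ ((1 : ℝ) / 4) with hAdef
  set R : ℝ := m ^ ((3 : ℝ) / 4) with hRdef
  have hm0 : 0 ≤ m := Nat.cast_nonneg _
  have hA64 : 64 ≤ A := le_trans (le_max_left _ _) hAge
  have hAε : 9 / min ε (1 / 4) ≤ A := le_trans (le_max_right _ _) hAge
  have hA0 : 0 < A := by linarith
  have hA1 : 1 ≤ A := by linarith
  have hmA : m = A ^ 4 := by rw [hAdef, ← Real.rpow_natCast, ← Real.rpow_mul hm0]; norm_num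
  have hRA : R = A ^ 3 := by rw [hRdef, hAdef, ← Real.rpow_natCast, ← Real.rpow_mul hm0]; norm_num
  have hR2 : 2 ≤ R := h34
  have hR0 : 0 < R := by linarith
  have hμ0 : 0 ≤ (N : ℝ) * pc n k := mul_nonneg (Nat.cast_nonneg _) hp0.le
  have hmμ : m ≤ (N : ℝ) * pc n k := Nat.floor_le hμ0
  have hμm : (N : ℝ) * pc n k < m + 1 := Nat.lt_floor_add_one _
  have hA3 : 0 < A ^ 3 := pow_pos hA0 3
  have h2R : 2 * R ≤ m := by rw [hRA, hmA]; nlinarith [hA3, hA64]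
  -- the slice at the bottom of the window
  set r : ℕ := ⌊R⌋₊ with hrdef
  have hrR : (r : ℝ) ≤ R := Nat.floor_le hR0.le
  have hRr : R < r + 1 := Nat.lt_floor_add_one R
  have hRm : R ≤ m := by linarith
  have hrm : r ≤ thr k n := by
    have : (r : ℝ) ≤ thr k n := hrR.trans hRm
    exact_mod_cast this
  set j : ℕ := thr k n - r with hjdef
  have hjcast : (j : ℝ) = m - r := by rw [hjdef, Nat.cast_sub hrm]
  have hj : Central k n j := by
    show |(j : ℝ) - (thr k n : ℝ)| ≤ (thr k n : ℝ) ^ ((3 : ℝ) / 4)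
    rw [hjcast, show m - (r : ℝ) - m = -r by ring, abs_neg, Nat.abs_cast]
    exact hrR
  have hwin5' : (thr k n : ℝ) ^ ((3 : ℝ) / 4) + (1 : ℕ) + 1 ≤ ((n.choose 2 : ℕ) : ℝ) * pc n k / 4 := by push_cast at hwin5 ⊢; linarith
  have hjN1 : j + 1 ≤ N := central_add_le (w := 1) hp0 hp8 hwin5' hj
  have hjN : j ≤ N := Nat.le_of_succ_le hjN1
  have hj1 : 2 ≤ j + 1 := by
    have : (1 : ℝ) ≤ j := by rw [hjcast]; linarith
    have : 1 ≤ j := by exact_mod_cast this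
    omega
  -- the circuit
  obtain ⟨e₀⟩ := exists_edge (show 2 ≤ n by omega)
  obtain ⟨D, hDB, hDs, hDe⟩ := exists_monotone_threshold (n := n) hj1 hjN1
  obtain ⟨C, hCB, hCs, hCe⟩ := exists_or_input e₀ D hDB
  have hsize : C.size ≤ n ^ 7 := by
    have hNn : N ≤ n ^ 2 := by
      rw [hNdef, Nat.choose_two_right]
      calc n * (n - 1) / 2 ≤ n * (n - 1) := Nat.div_le_self _ _
        _ ≤ n * n := Nat.mul_le_mul_left _ (Nat.sub_le _ _)
        _ = n ^ 2 := (pow_two n).symm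
    have h3 : N ^ 3 ≤ n ^ 6 := by
      calc N ^ 3 ≤ (n ^ 2) ^ 3 := Nat.pow_le_pow_left hNn 3
        _ = n ^ 6 := by rw [← pow_mul]
    have h7 : n ^ 7 = n ^ 6 * n := pow_succ _ _
    have hkey : 22 * n ^ 6 + n ^ 2 + 1 ≤ n ^ 6 * n := by
      have h1 : n ^ 6 * 23 ≤ n ^ 6 * n := Nat.mul_le_mul_left _ hn23
      have h4 : n ^ 2 + 1 ≤ n ^ 6 := by
        have h2 : 2 * n ^ 2 ≤ n ^ 6 :=
          calc 2 * n ^ 2 ≤ n * n ^ 2 := Nat.mul_le_mul_right _ (by omega)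
            _ = n ^ 3 := by ring
            _ ≤ n ^ 6 := Nat.pow_le_pow_right (by omega) (by norm_num)
        have h3 : 1 ≤ n ^ 2 := Nat.one_le_pow _ _ (by omega)
        omega
      omega
    have hDs' : D.size ≤ 22 * N ^ 3 + N := hDs
    calc C.size ≤ D.size + 1 := hCs
      _ ≤ 22 * N ^ 3 + N + 1 := by omega
      _ ≤ 22 * n ^ 6 + n ^ 2 + 1 := by omega
      _ ≤ n ^ 7 := by rw [h7]; exact hkey
  -- on the slice `j`, `C = x_{e₀}`
  set F : (Edge n → Bool) → Bool := fun y => y e₀ with hF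
  have hFmono : Monotone F := fun a b hab => hab e₀
  have hslice : ∀ x : Edge n → Bool, edgeCount x = j → C.eval x = F x := by
    intro x hx
    rw [hCe, hDe, hx]
    have : ¬ (j + 1 ≤ j) := by omega
    simp [this, hF]
  have htr : transport j (ind C.eval) = transport j (ind F) := by
    funext y
    unfold transport
    rw [sum_congr rfl fun x hx => show ind C.eval x = ind F x by simp only [ind, hslice x (mem_nbhd.1 hx).1]]
  -- part A for the dictator: `‖T_j 𝟙[F] - 𝟙[F]‖ ≤ 1·2R/N + Np(1-p)/(R/2)² ≤ 1/A + 8/A`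
  have hNp : (N : ℝ) * pc n k * (1 - pc n k) ≤ m + 1 := by
    have : (N : ℝ) * pc n k * (1 - pc n k) ≤ (N : ℝ) * pc n k := mul_le_of_le_one_right hμ0 (by linarith)
    linarith
  have hcheb8 : (N : ℝ) * pc n k * (1 - pc n k) / (R / 2) ^ 2 ≤ 8 / A := by
    have hR2pos : 0 < (R / 2) ^ 2 := by positivity
    rw [div_le_div_iff₀ hR2pos hA0]
    have hstep : (m + 1) * A ≤ 8 * (R / 2) ^ 2 := by
      rw [hRA, hmA]; exact numerics_aux hA1
    calc (N : ℝ) * pc n k * (1 - pc n k) * A ≤ (m + 1) * A := mul_le_mul_of_nonneg_right hNp hA0.le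
      _ ≤ 8 * (R / 2) ^ 2 := hstep
  have hstab : l1 n (pc n k) (transport j (ind F)) (ind F) ≤ 9 / A := by
    have hmain := l1_transport_local_le (dictator_local e₀) hp0.le hp1 hjN
      (fun i : ℕ => |(i : ℝ) - m| ≤ R) (by linarith : (0 : ℝ) ≤ 2 * R) (half_pos hR0)
      (fun i hi => by
        have hjm : |(m : ℝ) - j| ≤ R := by
          rw [hjcast, show m - (m - (r : ℝ)) = r by ring, Nat.abs_cast]; exact hrR
        calc |(i : ℝ) - j| ≤ |(i : ℝ) - m| + |(m : ℝ) - j| := abs_sub_le _ _ _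
          _ ≤ R + R := add_le_add hi hjm
          _ = 2 * R := by ring)
      (fun i _ hi => by
        push Not at hi
        have h1 : |(i : ℝ) - m| ≤ |(i : ℝ) - (N : ℝ) * pc n k| + |(N : ℝ) * pc n k - m| := abs_sub_le _ _ _
        have h2 : |(N : ℝ) * pc n k - m| < 1 := by
          rw [abs_lt]; constructor <;> linarith
        linarith)
    refine hmain.trans ?_
    have hT : (#({e₀} : Finset (Edge n)) : ℝ) = 1 := by rw [card_singleton, Nat.cast_one]
    have hN8 : 8 * m ≤ (N : ℝ) := by
      have : (N : ℝ) * pc n k ≤ (N : ℝ) * (1 / 8) := mul_le_mul_of_nonneg_left hp8 (Nat.cast_nonneg _)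
      linarith
    have hNpos : (0 : ℝ) < N := by linarith [show 0 < m by rw [hmA]; positivity]
    have hterm1 : (#({e₀} : Finset (Edge n)) : ℝ) * (2 * R) / (N : ℝ) ≤ 1 / A := by
      rw [hT, one_mul, div_le_div_iff₀ hNpos hA0, hRA, one_mul]
      have : 2 * A ^ 3 * A = 2 * m := by rw [hmA]; ring
      nlinarith [this, hN8, hm0]
    linarith [hterm1, hcheb8, show 1 / A + 8 / A = 9 / A by ring]
  have h9A : 9 / A ≤ min ε (1 / 4) := by
    rw [div_le_iff₀ hA0]; rw [div_le_iff₀ hε4] at hAε; linarith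
  -- (i) the hypothesis holds with `F = y_{e₀}`; (ii) `C` is far from its own transport
  refine ⟨j, hj, C, hCB, hsize, ⟨F, hFmono, ?_⟩, ?_⟩
  · rw [htr, l1_comm]
    exact hstab.trans (h9A.trans (min_le_left _ _))
  · rw [htr]
    have htri := l1_triangle hp0.le hp1 (ind C.eval) (transport j (ind F)) (ind F)
    have hstab' : l1 n (pc n k) (transport j (ind F)) (ind F) ≤ 1 / 4 := hstab.trans (h9A.trans (min_le_right _ _))
    -- `‖𝟙[C] - 𝟙[F]‖ ≥ 1 - Pr[|y| ≤ j] - Pr[y e₀ = 1] ≥ 1 - 8/A - 1/8 ≥ 3/4`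
    have hfar : (3 / 4 : ℝ) ≤ l1 n (pc n k) (ind C.eval) (ind F) := by
      set p : ℝ := pc n k with hp
      have hw0 : ∀ y, 0 ≤ gnpWeight n p y := fun y => gnpWeight_nonneg hp0.le hp1 y
      have hpt : ∀ y : Edge n → Bool, gnpWeight n p y * (1 - (if edgeCount y ≤ j then (1 : ℝ) else 0)
          - (if y e₀ = true then (1 : ℝ) else 0)) ≤ gnpWeight n p y * |ind C.eval y - ind F y| := by
        intro y
        refine mul_le_mul_of_nonneg_left ?_ (hw0 y)
        have habs := abs_nonneg (ind C.eval y - ind F y)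
        have hi1 : (0 : ℝ) ≤ (if edgeCount y ≤ j then (1 : ℝ) else 0) := by split_ifs <;> norm_num
        have hi2 : (0 : ℝ) ≤ (if y e₀ = true then (1 : ℝ) else 0) := by split_ifs <;> norm_num
        by_cases hy : edgeCount y ≤ j
        · rw [if_pos hy]; linarith
        · by_cases hye : y e₀ = true
          · rw [if_pos hye]; linarith
          · rw [if_neg hy, if_neg hye]
            have hCy : C.eval y = true := by
              rw [hCe, hDe]
              simp only [Bool.or_eq_true, decide_eq_true_eq]
              right; omega
            have hFy : F y = false := Bool.eq_false_iff.2 hye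
            have hval : ind C.eval y - ind F y = 1 := by
              unfold ind
              rw [hCy, hFy]
              norm_num
            rw [hval]
            norm_num
      have hsum := sum_le_sum fun y (_ : y ∈ (univ : Finset (Edge n → Bool))) => hpt y
      have hl1 : ∑ y, gnpWeight n p y * |ind C.eval y - ind F y| = l1 n p (ind C.eval) (ind F) := rfl
      rw [hl1] at hsum
      have hone : ∑ y : Edge n → Bool, gnpWeight n p y = 1 := sum_gnpWeight p
      have hedge := sum_gnpWeight_ite_coord (n := n) p e₀
      have htail : ∑ y : Edge n → Bool, gnpWeight n p y * (if edgeCount y ≤ j then (1 : ℝ) else 0) ≤ 8 / A := by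
        rw [sum_gnpWeight_ite_edgeCount_le]
        set b : ℕ → ℝ := fun i => (N.choose i : ℝ) * p ^ i * (1 - p) ^ (N - i) with hbdef
        have hb : ∀ i, b i = (N.choose i : ℝ) * p ^ i * (1 - p) ^ (N - i) := fun i => rfl
        have hcheb := binomialWeight_tail_le hb hp0.le hp1 (half_pos hR0) (fun i => i ≤ j) (fun i hi => by
          have hi' : (i : ℝ) ≤ m - r := by rw [← hjcast]; exact_mod_cast hi
          rw [abs_sub_comm, abs_of_nonneg (by linarith)]
          linarith)
        exact hcheb.trans hcheb8
      have hsplit : ∑ y : Edge n → Bool, gnpWeight n p y * (1 - (if edgeCount y ≤ j then (1 : ℝ) else 0)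
          - (if y e₀ = true then (1 : ℝ) else 0))
          = ∑ y : Edge n → Bool, gnpWeight n p y
            - ∑ y : Edge n → Bool, gnpWeight n p y * (if edgeCount y ≤ j then (1 : ℝ) else 0)
            - ∑ y : Edge n → Bool, gnpWeight n p y * (if y e₀ = true then (1 : ℝ) else 0) := by
        rw [← sum_sub_distrib, ← sum_sub_distrib]
        exact sum_congr rfl fun y _ => by ring
      rw [hsplit, hone, hedge] at hsum
      have h8A : 8 / A ≤ 1 / 8 := by rw [div_le_div_iff₀ hA0 (by norm_num)]; linarith
      have hp8' : p ≤ 1 / 8 := hp8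
      linarith
    linarith only [htri, hstab', hfar]

/-- **Transport rigidity fails** (`c = 7`, every `k ≥ 3`, `η = 1/4`; the strengthening `TransportRigidity` of the work file is
stated inline: "whenever the hypothesis of MC holds, `C` itself is `η`-close to its own slice transport"). The continuation `C'`
promised by MC cannot in general be `C` itself — nor any circuit that agrees with `C` off a `G(n,p_c)`-null set — even when the
hypothesis holds with `ε → 0`. A proof of MC must build `C'` from the profile `ĝ_C`, not reuse the gates of `C`. [folklore] -/
theorem not_transportRigidity :
    ¬ ∀ c k : ℕ, 3 ≤ k → ∀ η : ℝ, 0 < η → ∃ ε : ℝ, 0 < ε ∧ ∀ᶠ n : ℕ in atTop, ∀ j : ℕ, Central k n j →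
        ∀ C : Circuit (Edge n), C.IsOver monotoneBasis → C.size ≤ n ^ c →
          (∃ F : (Edge n → Bool) → Bool, Monotone F ∧ l1 n (pc n k) (ind F) (transport j (ind C.eval)) ≤ ε) →
          l1 n (pc n k) (ind C.eval) (transport j (ind C.eval)) ≤ η := by
  intro h
  obtain ⟨ε, hε, H⟩ := h 7 3 le_rfl (1 / 4) (by norm_num)
  obtain ⟨n, hn, hwn⟩ := (H.and (eventually_rigidity_witness (k := 3) le_rfl hε)).exists
  obtain ⟨j, hj, C, hC, hCs, hF, hfar⟩ := hwn
  have := hn j hj C hC hCs hF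
  linarith

end

end Summit.PneNP.PneNP.Theorems.MonotoneContinuation.Negative
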